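import Summits.CriticalPhenomena.PercolationContinuityZ3.Theorems.PercNearOneGluingNoHeavyLowerTailThreeHairSlices
import Summits.CriticalPhenomena.PercolationContinuityZ3.Theorems.PercNearOneGluingNoHeavyLowerTailSourceRepellerExchange
import HarnessLib

/-!
# `NoHeavyLowerTail` (stmt-CriticalPhenomena-4575) — (Y13) and KN Question 7 at `|A| = 3` for ONE-LAYER observers

Route `PercNearOneGluingNoHeavy`, crux `NoHeavyLowerTail`; registered stub `stub_sourceRepellerExchangeThreeRelays` (= (Y13),
the hypothesis of `preFKG3_of_stubSourceRepellerExchange`):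
`μ(N₂ ∩ {a₂↔o})·(J₁g₃ − J₃g₁) ≤ μ(N₂)·(G₁g₃ − G₃g₁)`.
This file proves it for every finite weighted graph whose observer `o` carries positive weight only on its pairs to the three
relays `a₁, a₂, a₃` — Kozma–Nitzan's one-layer observer class of Theorem 4 (arXiv:2401.12397, p. 13) — (`y13_oneLayer`,
`th_y13_threeHair_general`), extending the two-hair case `y13_twoHair`, and deduces the `τ`-designated pre-FKG inequality
(Question 7 at `|A| = 3`) for this class (`preFKG3_oneLayer`); Theorem 4 itself only gives the min-form (3) there.

Method.  The eight measures are expanded along the eight star events (`th3_exp_*`, file `…ThreeHairSlices`); the star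
weights are products of the hair weights `q = w{o,a₁}`, `p = w{o,a₂}`, `r = w{o,a₃}` (`th_real_starEvent_three`); five linear
relations (`th_rel_*`) reduce the nine off-`o` measures to eight atoms `jb, jt, n1b, n1t, zb, zt, e, n2`; the margin is then
IDENTICALLY `n2 · p q (1−p)(1−q)(1−r) · Q̂` where `Q̂ = (1−p)(1−q)C₀₀ + (1−p)q C₀₁ + p(1−q)C₁₀ + pq C₁₁` and each corner
polynomial is an explicit nonnegative combination (coefficients `r, 1−r, 2−r`, atoms) of the three BHK exchange rows
`Z' = zt·rb − zb·rt ≥ 0` (`th_L1_general`), `W = jb·rt − jt·rb ≥ 0` (`th_L2_general`), `n1b·zt − zb·n1t ≥ 0` (`th_L3_general`);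
`linarith` checks the polynomial identity.  General observers (the stub itself) remain open — see the item's evidence
`RESIDUAL-gen9.md` (§9b is this theorem).
-/

namespace Summit.CriticalPhenomena.PercolationContinuityZ3.Theorems

open MeasureTheory Set Literature.Probability.LatticeModels Literature.Probability.Percolation
open Literature.Probability.Percolation.KNPreFKG

noncomputable section

open Classical

section Relations3

variable {W : Type*} [Fintype W] (u : Sym2 W → unitInterval) (b a₁ a₂ a₃ : W)

/-- `μ(R∩B) = μ(R∩J∩B) + μ(N₁∩B)` (`R = {a₁↮a₃}`, `J = {a₁↔a₂}`, `N₁ = R ∩ Jᶜ`). [folklore] -/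
theorem th_rel_split_J (X : Set (BondConfig W)) :
    (prodBernoulli u).real ((openConn a₁ a₃)ᶜ ∩ X) =
      (prodBernoulli u).real ((openConn a₁ a₃)ᶜ ∩ (openConn a₁ a₂ ∩ X)) +
        (prodBernoulli u).real ((openConn a₁ a₂)ᶜ ∩ (openConn a₁ a₃)ᶜ ∩ X) := by
  have h := measureReal_inter_add_sdiff (μ := prodBernoulli u) (s := ((openConn a₁ a₃)ᶜ ∩ X : Set (BondConfig W)))
    (t := openConn a₁ a₂) MeasurableSet.of_discrete
  have e1 : (((openConn a₁ a₃)ᶜ ∩ X) ∩ openConn a₁ a₂ : Set (BondConfig W)) = (openConn a₁ a₃)ᶜ ∩ (openConn a₁ a₂ ∩ X) := by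
    ext ω; simp only [Set.mem_inter_iff, Set.mem_compl_iff]; tauto
  have e2 : (((openConn a₁ a₃)ᶜ ∩ X) \ openConn a₁ a₂ : Set (BondConfig W)) = (openConn a₁ a₂)ᶜ ∩ (openConn a₁ a₃)ᶜ ∩ X := by
    ext ω; simp only [Set.mem_sdiff, Set.mem_inter_iff, Set.mem_compl_iff]; tauto
  rw [e1, e2] at h
  exact h.symm

/-- `μ(N₁₂ ∩ X) = μ(R ∩ X) − μ(R ∩ {a₃↔a₂} ∩ X)` (`N₁₂ = R ∩ {a₃↮a₂}`). [folklore] -/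
theorem th_rel_split_Z (X : Set (BondConfig W)) :
    (prodBernoulli u).real ((openConn a₁ a₃)ᶜ ∩ (openConn a₃ a₂)ᶜ ∩ X) =
      (prodBernoulli u).real ((openConn a₁ a₃)ᶜ ∩ X) - (prodBernoulli u).real ((openConn a₁ a₃)ᶜ ∩ (openConn a₃ a₂ ∩ X)) := by
  have h := measureReal_inter_add_sdiff (μ := prodBernoulli u) (s := ((openConn a₁ a₃)ᶜ ∩ X : Set (BondConfig W)))
    (t := openConn a₃ a₂) MeasurableSet.of_discrete
  have e1 : (((openConn a₁ a₃)ᶜ ∩ X) ∩ openConn a₃ a₂ : Set (BondConfig W)) = (openConn a₁ a₃)ᶜ ∩ (openConn a₃ a₂ ∩ X) := by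
    ext ω; simp only [Set.mem_inter_iff, Set.mem_compl_iff]; tauto
  have e2 : (((openConn a₁ a₃)ᶜ ∩ X) \ openConn a₃ a₂ : Set (BondConfig W)) = (openConn a₁ a₃)ᶜ ∩ (openConn a₃ a₂)ᶜ ∩ X := by
    ext ω; simp only [Set.mem_sdiff, Set.mem_inter_iff, Set.mem_compl_iff]; tauto
  rw [e1, e2] at h
  linarith

/-- `μ(N₁ ∩ (T ∪ B₂)) = μ(N₁ ∩ T) + μ(N₁ ∩ B₂ ∩ Tᶜ)`. [folklore] -/
theorem th_rel_n1tb2 :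
    (prodBernoulli u).real ((openConn a₁ a₂)ᶜ ∩ (openConn a₁ a₃)ᶜ ∩ (openConn a₃ b ∪ openConn a₂ b)) =
      (prodBernoulli u).real ((openConn a₁ a₂)ᶜ ∩ (openConn a₁ a₃)ᶜ ∩ openConn a₃ b) +
        (prodBernoulli u).real ((openConn a₁ a₂)ᶜ ∩ (openConn a₁ a₃)ᶜ ∩ (openConn a₂ b ∩ (openConn a₃ b)ᶜ)) := by
  have h := measureReal_inter_add_sdiff (μ := prodBernoulli u)
    (s := ((openConn a₁ a₂)ᶜ ∩ (openConn a₁ a₃)ᶜ ∩ (openConn a₃ b ∪ openConn a₂ b) : Set (BondConfig W)))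
    (t := openConn a₃ b) MeasurableSet.of_discrete
  have e1 : (((openConn a₁ a₂)ᶜ ∩ (openConn a₁ a₃)ᶜ ∩ (openConn a₃ b ∪ openConn a₂ b)) ∩ openConn a₃ b : Set (BondConfig W)) =
      (openConn a₁ a₂)ᶜ ∩ (openConn a₁ a₃)ᶜ ∩ openConn a₃ b := by
    ext ω; simp only [Set.mem_inter_iff, Set.mem_compl_iff, Set.mem_union]; tauto
  have e2 : (((openConn a₁ a₂)ᶜ ∩ (openConn a₁ a₃)ᶜ ∩ (openConn a₃ b ∪ openConn a₂ b)) \ openConn a₃ b : Set (BondConfig W)) =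
      (openConn a₁ a₂)ᶜ ∩ (openConn a₁ a₃)ᶜ ∩ (openConn a₂ b ∩ (openConn a₃ b)ᶜ) := by
    ext ω; simp only [Set.mem_sdiff, Set.mem_inter_iff, Set.mem_compl_iff, Set.mem_union]; tauto
  rw [e1, e2] at h
  exact h.symm

/-- `μ(N₁₂ ∩ (B ∪ B₂)) = μ(R∩B) − μ(R ∩ {a₃↔a₂} ∩ B) + μ(N₁ ∩ B₂ ∩ Tᶜ)`: on `N₁₂`, `b ↔ a₂` with `b ↮ a₁` forces `a₁ ↮ a₂` and
`b ↮ a₃` (transitivity). [folklore] -/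
theorem th_rel_wb :
    (prodBernoulli u).real ((openConn a₁ a₃)ᶜ ∩ (openConn a₃ a₂)ᶜ ∩ (openConn a₁ b ∪ openConn a₂ b)) =
      (prodBernoulli u).real ((openConn a₁ a₃)ᶜ ∩ openConn a₁ b) -
          (prodBernoulli u).real ((openConn a₁ a₃)ᶜ ∩ (openConn a₃ a₂ ∩ openConn a₁ b)) +
        (prodBernoulli u).real ((openConn a₁ a₂)ᶜ ∩ (openConn a₁ a₃)ᶜ ∩ (openConn a₂ b ∩ (openConn a₃ b)ᶜ)) := by
  have h := measureReal_inter_add_sdiff (μ := prodBernoulli u)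
    (s := ((openConn a₁ a₃)ᶜ ∩ (openConn a₃ a₂)ᶜ ∩ (openConn a₁ b ∪ openConn a₂ b) : Set (BondConfig W)))
    (t := openConn a₁ b) MeasurableSet.of_discrete
  have e1 : (((openConn a₁ a₃)ᶜ ∩ (openConn a₃ a₂)ᶜ ∩ (openConn a₁ b ∪ openConn a₂ b)) ∩ openConn a₁ b : Set (BondConfig W)) =
      (openConn a₁ a₃)ᶜ ∩ (openConn a₃ a₂)ᶜ ∩ openConn a₁ b := by
    ext ω; simp only [Set.mem_inter_iff, Set.mem_compl_iff, Set.mem_union]; tauto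
  have e2 : (((openConn a₁ a₃)ᶜ ∩ (openConn a₃ a₂)ᶜ ∩ (openConn a₁ b ∪ openConn a₂ b)) \ openConn a₁ b : Set (BondConfig W)) =
      (openConn a₁ a₂)ᶜ ∩ (openConn a₁ a₃)ᶜ ∩ (openConn a₂ b ∩ (openConn a₃ b)ᶜ) := by
    ext ω
    simp only [Set.mem_sdiff, Set.mem_inter_iff, Set.mem_compl_iff, Set.mem_union]
    constructor
    · rintro ⟨⟨⟨h13, h32⟩, h1b | h2b⟩, hn1b⟩
      · exact absurd h1b hn1b
      · refine ⟨⟨fun h12 => hn1b ?_, h13⟩, h2b, fun h3b => h32 ?_⟩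
        · exact SimpleGraph.Reachable.trans h12 h2b
        · exact SimpleGraph.Reachable.trans h3b (SimpleGraph.Reachable.symm h2b)
    · rintro ⟨⟨h12, h13⟩, h2b, h3b⟩
      refine ⟨⟨⟨h13, fun h32 => h3b ?_⟩, Or.inr h2b⟩, fun h1b => h12 ?_⟩
      · exact SimpleGraph.Reachable.trans h32 h2b
      · exact SimpleGraph.Reachable.trans h1b (SimpleGraph.Reachable.symm h2b)
  rw [e1, e2, th_rel_split_Z u a₁ a₂ a₃ (openConn a₁ b)] at h
  linarith

omit [Fintype W] in
/-- `N₁ ∩ {a₂↔a₃} ∩ X = R ∩ {a₃↔a₂} ∩ X` (on `R`, `a₃ ↔ a₂` forces `a₁ ↮ a₂`). [folklore] -/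
theorem th_rel_zswap (X : Set (BondConfig W)) :
    ((openConn a₁ a₂)ᶜ ∩ (openConn a₁ a₃)ᶜ ∩ (openConn a₂ a₃ ∩ X) : Set (BondConfig W)) =
      (openConn a₁ a₃)ᶜ ∩ (openConn a₃ a₂ ∩ X) := by
  ext ω
  simp only [Set.mem_inter_iff, Set.mem_compl_iff]
  constructor
  · rintro ⟨⟨_, h13⟩, h23, hX⟩
    exact ⟨h13, SimpleGraph.Reachable.symm h23, hX⟩
  · rintro ⟨h13, h32, hX⟩
    exact ⟨⟨fun h12 => h13 (SimpleGraph.Reachable.trans h12 (SimpleGraph.Reachable.symm h32)), h13⟩,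
      SimpleGraph.Reachable.symm h32, hX⟩

end Relations3

section Assembly3

variable {V : Type*} [Fintype V]

/-- **(Y13) for one-layer (three-hair) observers, general vertex type.**  If the observer `o` has (positive-weight) pairs
only to the three relays `a₁, a₂, a₃`, then `μ(N₂ ∩ {a₂↔o})·(J₁g₃ − J₃g₁) ≤ μ(N₂)·(G₁g₃ − G₃g₁)` — the registered
source/repeller exchange inequality `stub_sourceRepellerExchangeThreeRelays` for this observer class (Kozma–Nitzan's Theorem-4
class).  Proof: star integration over the eight `σ_B` (the eight measures are affine in the star weights with nine coefficients
measured off `o`); with product star weights the margin is `p q (1−p)(1−q)(1−r)·μ'(N₂)·Q̂` and `Q̂`, bilinear in `(p,q)`,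
has the four corner polynomials of RESIDUAL-gen9 §9b, each a nonnegative combination of the BHK rows L1, L2, L3 off `o`.
[cite: KozmaNitzan2024, Lemma 5 and proof of Thm. 4 (pp. 13–14)] [cite: VandenbergHaggstromKahn2005, Thms. 1.3–1.5, 2.1] -/
theorem th_y13_threeHair_general (w : Sym2 V → unitInterval) (o : V) (a₁ a₂ a₃ b : ({o}ᶜ : Set V))
    (h12 : (a₁ : V) ≠ a₂) (h13 : (a₁ : V) ≠ a₃) (h23 : (a₂ : V) ≠ a₃)
    (hiso : ∀ u, u ≠ o → u ∉ ({(a₁ : V), (a₂ : V), (a₃ : V)} : Finset V) → w s(o, u) = 0) :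
    (prodBernoulli w).real ((openConn (a₂ : V) (a₁ : V))ᶜ ∩ (openConn (a₂ : V) (a₃ : V))ᶜ ∩ openConn (a₂ : V) o) *
        ((prodBernoulli w).real ((openConn (a₁ : V) (a₃ : V))ᶜ ∩ (openConn (a₁ : V) (a₂ : V) ∩ openConn (a₁ : V) (b : V))) * (prodBernoulli w).real ((openConn (a₁ : V) (a₃ : V))ᶜ ∩ openConn (a₃ : V) (b : V)) -
          (prodBernoulli w).real ((openConn (a₁ : V) (a₃ : V))ᶜ ∩ (openConn (a₁ : V) (a₂ : V) ∩ openConn (a₃ : V) (b : V))) * (prodBernoulli w).real ((openConn (a₁ : V) (a₃ : V))ᶜ ∩ openConn (a₁ : V) (b : V))) ≤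
      (prodBernoulli w).real ((openConn (a₂ : V) (a₁ : V))ᶜ ∩ (openConn (a₂ : V) (a₃ : V))ᶜ) *
        ((prodBernoulli w).real ((openConn (a₁ : V) (a₃ : V))ᶜ ∩ (openConn (a₁ : V) o ∩ openConn (a₁ : V) (b : V))) * (prodBernoulli w).real ((openConn (a₁ : V) (a₃ : V))ᶜ ∩ openConn (a₃ : V) (b : V)) -
          (prodBernoulli w).real ((openConn (a₁ : V) (a₃ : V))ᶜ ∩ (openConn (a₁ : V) o ∩ openConn (a₃ : V) (b : V))) * (prodBernoulli w).real ((openConn (a₁ : V) (a₃ : V))ᶜ ∩ openConn (a₁ : V) (b : V))) := by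
  have h1o : (a₁ : V) ≠ o := a₁.2
  have h2o : (a₂ : V) ≠ o := a₂.2
  have h3o : (a₃ : V) ≠ o := a₃.2
  have h13' : a₁ ≠ a₃ := fun h => h13 (congrArg Subtype.val h)
  -- hair weights
  set q : ℝ := ((w s(o, (a₁ : V)) : unitInterval) : ℝ) with hq
  set p : ℝ := ((w s(o, (a₂ : V)) : unitInterval) : ℝ) with hp
  set r : ℝ := ((w s(o, (a₃ : V)) : unitInterval) : ℝ) with hr
  have hq0 : 0 ≤ q := (w s(o, (a₁ : V))).2.1
  have hq1 : q ≤ 1 := (w s(o, (a₁ : V))).2.2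
  have hp0 : 0 ≤ p := (w s(o, (a₂ : V))).2.1
  have hp1 : p ≤ 1 := (w s(o, (a₂ : V))).2.2
  have hr0 : 0 ≤ r := (w s(o, (a₃ : V))).2.1
  have hr1 : r ≤ 1 := (w s(o, (a₃ : V))).2.2
  -- star weights are products
  have hsw := fun (B : Finset V) (hB : B ⊆ ({(a₁ : V), (a₂ : V), (a₃ : V)} : Finset V)) =>
    th_real_starEvent_three w h12 h13 h23 h1o.symm h2o.symm h3o.symm hiso B hB
  have s0 : (prodBernoulli w).real (starEvent o (∅ : Set V)) = (1 - q) * ((1 - p) * (1 - r)) := by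
    simpa using hsw ∅ (by simp)
  have s1 : (prodBernoulli w).real (starEvent o ({(a₁ : V)} : Set V)) = q * ((1 - p) * (1 - r)) := by
    simpa [h12, h13, h12.symm, h13.symm] using hsw {(a₁ : V)} (by simp [Finset.subset_iff])
  have s2 : (prodBernoulli w).real (starEvent o ({(a₂ : V)} : Set V)) = (1 - q) * (p * (1 - r)) := by
    simpa [h12, h23, h12.symm, h23.symm] using hsw {(a₂ : V)} (by simp [Finset.subset_iff])
  have s3 : (prodBernoulli w).real (starEvent o ({(a₃ : V)} : Set V)) = (1 - q) * ((1 - p) * r) := by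
    simpa [h13, h23, h13.symm, h23.symm] using hsw {(a₃ : V)} (by simp [Finset.subset_iff])
  have s12 : (prodBernoulli w).real (starEvent o ({(a₁ : V), (a₂ : V)} : Set V)) = q * (p * (1 - r)) := by
    simpa [h12, h13, h23, h12.symm, h13.symm, h23.symm] using hsw {(a₁ : V), (a₂ : V)} (by simp [Finset.subset_iff])
  have s13 : (prodBernoulli w).real (starEvent o ({(a₁ : V), (a₃ : V)} : Set V)) = q * ((1 - p) * r) := by
    simpa [h12, h13, h23, h12.symm, h13.symm, h23.symm] using hsw {(a₁ : V), (a₃ : V)} (by simp [Finset.subset_iff])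
  have s23 : (prodBernoulli w).real (starEvent o ({(a₂ : V), (a₃ : V)} : Set V)) = (1 - q) * (p * r) := by
    simpa [h12, h13, h23, h12.symm, h13.symm, h23.symm] using hsw {(a₂ : V), (a₃ : V)} (by simp [Finset.subset_iff])
  -- expand the eight measures along the star
  rw [th3_exp_A2 w o a₁ a₂ a₃ h12 h13 h23 hiso, th3_exp_P2 w o a₁ a₂ a₃ h12 h13 h23 hiso,
    th3_exp_g1 w o a₁ a₂ a₃ b h12 h13 h23 hiso, th3_exp_g3 w o a₁ a₂ a₃ b h12 h13 h23 hiso,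
    th3_exp_J1 w o a₁ a₂ a₃ b h12 h13 h23 hiso, th3_exp_J3 w o a₁ a₂ a₃ b h12 h13 h23 hiso,
    th3_exp_G1 w o a₁ a₂ a₃ b h12 h13 h23 hiso, th3_exp_G3 w o a₁ a₂ a₃ b h12 h13 h23 hiso,
    s0, s1, s2, s3, s12, s13, s23]
  -- the world off `o`
  set u := w ∘ Sym2.map (Subtype.val : ({o}ᶜ : Set V) → V) with hu
  have hL1 := th_L1_general u b a₁ a₂ a₃ h13'
  have hL2 := th_L2_general u b a₁ a₂ a₃ h13'
  have hL3 := th_L3_general u b a₁ a₂ a₃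
  rw [th_rel_zswap a₁ a₂ a₃, th_rel_zswap a₁ a₂ a₃] at hL3
  have hFv : (prodBernoulli u).real ((openConn a₁ a₃)ᶜ ∩ (openConn a₃ a₂ ∩ openConn a₁ b)) ≤
      (prodBernoulli u).real ((openConn a₁ a₂)ᶜ ∩ (openConn a₁ a₃)ᶜ ∩ openConn a₁ b) := by
    rw [← th_rel_zswap a₁ a₂ a₃]
    exact measureReal_mono (Set.inter_subset_inter_right _ Set.inter_subset_right)
  have hGv : (prodBernoulli u).real ((openConn a₁ a₃)ᶜ ∩ (openConn a₃ a₂ ∩ openConn a₃ b)) ≤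
      (prodBernoulli u).real ((openConn a₁ a₂)ᶜ ∩ (openConn a₁ a₃)ᶜ ∩ openConn a₃ b) := by
    rw [← th_rel_zswap a₁ a₂ a₃]
    exact measureReal_mono (Set.inter_subset_inter_right _ Set.inter_subset_right)
  -- symbols → atoms
  rw [openConn_symm a₂ a₁, th_rel_wb u b a₁ a₂ a₃, th_rel_split_Z u a₁ a₂ a₃ (openConn a₃ b), th_rel_n1tb2 u b a₁ a₂ a₃,
    th_rel_split_J u a₁ a₂ a₃ (openConn a₁ b), th_rel_split_J u a₁ a₂ a₃ (openConn a₃ b)]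
  rw [th_rel_split_J u a₁ a₂ a₃ (openConn a₁ b), th_rel_split_J u a₁ a₂ a₃ (openConn a₃ b)] at hL1 hL2
  set jb := (prodBernoulli u).real ((openConn a₁ a₃)ᶜ ∩ (openConn a₁ a₂ ∩ openConn a₁ b))
  set jt := (prodBernoulli u).real ((openConn a₁ a₃)ᶜ ∩ (openConn a₁ a₂ ∩ openConn a₃ b))
  set n1b := (prodBernoulli u).real ((openConn a₁ a₂)ᶜ ∩ (openConn a₁ a₃)ᶜ ∩ openConn a₁ b)
  set n1t := (prodBernoulli u).real ((openConn a₁ a₂)ᶜ ∩ (openConn a₁ a₃)ᶜ ∩ openConn a₃ b)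
  set zb := (prodBernoulli u).real ((openConn a₁ a₃)ᶜ ∩ (openConn a₃ a₂ ∩ openConn a₁ b))
  set zt := (prodBernoulli u).real ((openConn a₁ a₃)ᶜ ∩ (openConn a₃ a₂ ∩ openConn a₃ b))
  set e := (prodBernoulli u).real ((openConn a₁ a₂)ᶜ ∩ (openConn a₁ a₃)ᶜ ∩ (openConn a₂ b ∩ (openConn a₃ b)ᶜ))
  set n2 := (prodBernoulli u).real ((openConn a₁ a₂)ᶜ ∩ (openConn a₂ a₃)ᶜ : Set (BondConfig ({o}ᶜ : Set V)))
  have hjb : 0 ≤ jb := measureReal_nonneg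
  have hjt : 0 ≤ jt := measureReal_nonneg
  have hn1b : 0 ≤ n1b := measureReal_nonneg
  have hn1t : 0 ≤ n1t := measureReal_nonneg
  have hzb : 0 ≤ zb := measureReal_nonneg
  have hzt : 0 ≤ zt := measureReal_nonneg
  have he : 0 ≤ e := measureReal_nonneg
  have hn2 : 0 ≤ n2 := measureReal_nonneg
  -- the three BHK rows and the two atom differences, as nonnegative reals
  have hZ' : 0 ≤ zt * (jb + n1b) - zb * (jt + n1t) := by linarith
  have hW : 0 ≤ jb * (jt + n1t) - jt * (jb + n1b) := by linarith
  have hL3' : 0 ≤ n1b * zt - zb * n1t := by linarith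
  have hFv' : 0 ≤ n1b - zb := by linarith
  have hGv' : 0 ≤ n1t - zt := by linarith
  have h1p : 0 ≤ 1 - p := by linarith
  have h1q : 0 ≤ 1 - q := by linarith
  have h1r : 0 ≤ 1 - r := by linarith
  have h2r : 0 ≤ 2 - r := by linarith
  have h2 : (0 : ℝ) ≤ 2 := by norm_num
  -- the corner certificate
  have hQ : 0 ≤
      (1 - p) * (1 - q) *
          ((zt * (jb + n1b) - zb * (jt + n1t)) + e * (jt + n1t) + r * (2 * (jb * (jt + n1t) - jt * (jb + n1b)) + e * (jb + n1b))) +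
        (1 - p) * q *
          ((zt * (jb + n1b) - zb * (jt + n1t)) + e * (jt + n1t) + r * (2 - r) * (jb * (jt + n1t) - jt * (jb + n1b)) +
            r * e * (jb + n1b)) +
        p * (1 - q) *
          ((1 - r) * (zt * (jb + n1b) - zb * (jt + n1t)) +
            r * ((jb * (jt + n1t) - jt * (jb + n1b)) + (n1b * zt - zb * n1t)) +
            r * (2 - r) * (jb * (jt + n1t) - jt * (jb + n1b)) +
            e * (zt + (n1t - zt) + (1 - r) * jt + r * (2 * jb + (1 - r) * zb + (2 - r) * (n1b - zb) + e))) +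
        p * q *
          (r * ((2 - r) * ((jb * (jt + n1t) - jt * (jb + n1b)) + (n1b * zt - zb * n1t) + e * (zt + (n1t - zt))) +
            e * (jb + (n1b - zb) + e))) := by
    apply_rules (maxDepth := 2000) [add_nonneg, mul_nonneg]
  have hmain := mul_nonneg (mul_nonneg hn2 (mul_nonneg (mul_nonneg (mul_nonneg (mul_nonneg hp0 hq0) h1p) h1q) h1r)) hQ
  linarith [hmain]

/-- **(Y13) for one-layer observers** (`Fin n`, the registered stub's shape): for every finite weighted graph in which the
observer `o` carries positive weight only on its pairs to the three relays `a₁, a₂, a₃` (Kozma–Nitzan's Theorem-4 observer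
class), the source/repeller exchange inequality `μ(N₂ ∩ {a₂↔o})·(J₁g₃ − J₃g₁) ≤ μ(N₂)·(G₁g₃ − G₃g₁)` of
`stub_sourceRepellerExchangeThreeRelays` holds. [cite: KozmaNitzan2024, Lemma 5, Thm. 4 (pp. 13–14)] -/
theorem y13_oneLayer {n : ℕ} (w : Sym2 (Fin n) → unitInterval) (o b a₁ a₂ a₃ : Fin n) (h12 : a₁ ≠ a₂) (h13 : a₁ ≠ a₃)
    (h23 : a₂ ≠ a₃) (ho1 : o ≠ a₁) (ho2 : o ≠ a₂) (ho3 : o ≠ a₃) (hob : o ≠ b)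
    (hiso : ∀ u, u ≠ o → u ∉ ({a₁, a₂, a₃} : Finset (Fin n)) → w s(o, u) = 0) :
    (prodBernoulli w).real ((openConn a₂ a₁)ᶜ ∩ (openConn a₂ a₃)ᶜ ∩ openConn a₂ o) *
        ((prodBernoulli w).real ((openConn a₁ a₃)ᶜ ∩ (openConn a₁ a₂ ∩ openConn a₁ b)) *
            (prodBernoulli w).real ((openConn a₁ a₃)ᶜ ∩ openConn a₃ b) -
          (prodBernoulli w).real ((openConn a₁ a₃)ᶜ ∩ (openConn a₁ a₂ ∩ openConn a₃ b)) *
            (prodBernoulli w).real ((openConn a₁ a₃)ᶜ ∩ openConn a₁ b)) ≤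
      (prodBernoulli w).real ((openConn a₂ a₁)ᶜ ∩ (openConn a₂ a₃)ᶜ) *
        ((prodBernoulli w).real ((openConn a₁ a₃)ᶜ ∩ (openConn a₁ o ∩ openConn a₁ b)) *
            (prodBernoulli w).real ((openConn a₁ a₃)ᶜ ∩ openConn a₃ b) -
          (prodBernoulli w).real ((openConn a₁ a₃)ᶜ ∩ (openConn a₁ o ∩ openConn a₃ b)) *
            (prodBernoulli w).real ((openConn a₁ a₃)ᶜ ∩ openConn a₁ b)) :=
  th_y13_threeHair_general w o ⟨a₁, Set.mem_compl_singleton_iff.2 ho1.symm⟩ ⟨a₂, Set.mem_compl_singleton_iff.2 ho2.symm⟩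
    ⟨a₃, Set.mem_compl_singleton_iff.2 ho3.symm⟩ ⟨b, Set.mem_compl_singleton_iff.2 hob.symm⟩ h12 h13 h23
    fun u hu hu' => hiso u hu (by simpa using hu')

/-- **Kozma–Nitzan Question 7 at `|A| = 3` for one-layer observers**: if `o` carries positive weight only on its pairs to
the relays `a₁, a₂, a₃`, `a₃` is `τ`-weakest (`τ(a₃) ≤ τ(a₁), τ(a₂)`) and `μ(M) > 0`, then
`P(o ↔ A, a₃ ↔ b) ≤ P(o ↔ A, o ↔ b)`, `A = {a₁,a₂,a₃}` — the `τ`-designated form, which Kozma–Nitzan's Theorem 4 (min-form (3)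
for this observer class) does not give.  From `y13_oneLayer` and `preFKG3_of_sourceRepellerExchange`.
[cite: KozmaNitzan2024, Thm. 4 (p. 13), Question 7 (§5.5)] -/
theorem preFKG3_oneLayer {n : ℕ} (w : Sym2 (Fin n) → unitInterval) (o b a₁ a₂ a₃ : Fin n) (h12 : a₁ ≠ a₂)
    (h13 : a₁ ≠ a₃) (h23 : a₂ ≠ a₃) (ho1 : o ≠ a₁) (ho2 : o ≠ a₂) (ho3 : o ≠ a₃) (hob : o ≠ b)
    (hiso : ∀ u, u ≠ o → u ∉ ({a₁, a₂, a₃} : Finset (Fin n)) → w s(o, u) = 0)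
    (hM : 0 < (prodBernoulli w).real
      ((openConn a₁ a₂)ᶜ ∩ (openConn a₁ a₃)ᶜ ∩ (openConn a₂ a₃)ᶜ : Set (BondConfig (Fin n))))
    (hτ₁ : (prodBernoulli w).real (openConn a₃ b) ≤ (prodBernoulli w).real (openConn a₁ b))
    (hτ₂ : (prodBernoulli w).real (openConn a₃ b) ≤ (prodBernoulli w).real (openConn a₂ b)) :
    (prodBernoulli w).real ((openConn o a₁ ∪ openConn o a₂ ∪ openConn o a₃) ∩ openConn a₃ b) ≤
      (prodBernoulli w).real ((openConn o a₁ ∪ openConn o a₂ ∪ openConn o a₃) ∩ openConn o b) :=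
  preFKG3_of_sourceRepellerExchange w o b a₁ a₂ a₃ h12 h13 h23 hM hτ₁ hτ₂
    (y13_oneLayer w o b a₁ a₂ a₃ h12 h13 h23 ho1 ho2 ho3 hob hiso)

end Assembly3

end

end Summit.CriticalPhenomena.PercolationContinuityZ3.Theorems
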